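import Summits.PneNP.PneNP.Theorems.ChebyshevTracialDesignLowDegreeMatchingSide

/-!
# Cell pnp-psdrank, route `ChebyshevTracialDesign`: the Grigoriev ⊗ Grigoriev virtual form around a cut is the KRONECKER PRODUCT of the two
# pseudo-matching forms of `K_U` and `K_Ū` — matching-side low-degree pricing from the ONE-CLIQUE PSD statements
# (crux `TracialDecayExp20`, stmt-PneNP-19878; eng g13, MEMO-13 §4(c))

Brick `…LowDegreeMatchingSide.sum_levelWeight_trace_nonpos_of_lowDegreeM` (p555519) prices a matching-side low-degree Gram family against an
ARBITRARY psd cut family at `≤ 0`, CONDITIONAL on the hypothesis `hPSD`: for every `t`-cut `U` the quadratic form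
`γ ↦ Σ_{F,F'} γ_F γ_{F'} μ_U(F ∪ F')` on coefficient vectors indexed by `{F : |F| ≤ k}` is nonnegative, `μ_U(G)` = `[G extends to a perfect
matching]·[no edge of G crosses U]·m_t(z_G)·m_{n−t}(e_G)` with the pseudo-matching moments `m_m(z) = ∏_{j<z}(m−1−2j)⁻¹`. This file reduces `hPSD` to the
two ONE-CLIQUE statements, which are (in the tree's vocabulary) exactly Potechin's theorem for the odd cliques `K_U` and `K_Ū`: the story
pseudo-expectation values `Ẽ[x_G] = ∏_{j<|G|}(m−1−2j)⁻¹` on partial matchings `G` of `K_m`, `m` odd, are index-degree-`m` pseudo-expectation values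
for the MOD 2 principle, hence `Ẽ[g²] ≥ 0` for `indexdeg(g) ≤ (m−1)/2` [cite: Potechin2019, Thm. 1.2, Example 3.4 and Cor. 3.10 (LIPIcs 124, 61:4–61:9)];
the linear degree range is Grigoriev's [cite: Grigoriev2001TCS, Cor. 2 (p. 622)].
* §1 `mem_of_cutCount_two`, `not_mem_of_cutCount_zero`, `card_eq_card_filter_three` — cut bookkeeping of edge sets.
* §2 **`extends_iff_parts_extend`** — for an edge set `G` with no `U`-crossing edge and `n` even: `G` extends to a perfect matching of `K_n` iff its
  part inside `U` and its part inside `Ū` both do (sub-matchings of perfect matchings are perfect matchings of the vertices they cover,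
  `IsPMOn.union` of the two vertex-disjoint parts, `exists_isPMOn_of_even` on the uncovered rest).
* §3 `exists_gram_of_posSemidef'` (Gram factor of a real psd matrix on any finite index type), **`kronecker_form_nonneg`** — if `T` (on `β`) and `V`
  (on `κ`) are nonnegative quadratic forms (`T` symmetric) then `Σ_{a,a'} f_a f_{a'} T(p a, p a') V(q a, q a') ≥ 0` for any maps `p : α → β`,
  `q : α → κ` and coefficients `f` (Gram-factor `T`, regroup the `α`-sum along the fibres of `q`).
* §4 **`virtualForm_nonneg_of_clique_forms`** — the per-cut hypothesis `hPSD U` of p555519 follows from the two one-clique forms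
  `δ ↦ Σ δ_A δ_{A'} ν_U(A ∪ A')`, `ν_U(G) = [G ⊆ E(U) extends to a perfect matching]·∏_{j<|G|}(t−1−2j)⁻¹`, and the same for `Ū` with `n − t`;
  **`sum_levelWeight_trace_nonpos_of_lowDegreeM_of_clique_forms`** — the pricing theorem with the one-clique forms as its only hypotheses.
Stature: support/instrument (no defs, axioms standard; CONDITIONAL on the one-clique PSD statements = Potechin's theorem, to be typed under
Literature/Computability/Complexity). WHAT THIS IS NOT: no proof of Potechin's theorem, nothing on the dense cell, nothing on psd rank, no P-vs-NP content.
Supports stmt-PneNP-19878.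
-/

set_option linter.dupNamespace false -- `Summit.PneNP.PneNP.…`: summit = sub-problem (D-0017)

noncomputable section

namespace Summit.PneNP.PneNP.Theorems.ChebyshevTracialDesignPseudoMatchingTensor

open Finset Matrix Literature.Barriers.PneNP Literature.Combinatorics.Optimization
open Summit.PneNP.PneNP.Theorems.ChebyshevTracialDesignJunta
open Summit.PneNP.PneNP.Theorems.ChebyshevTracialDesignMonomialVirtualValue
open Summit.PneNP.PneNP.Theorems.ChebyshevTracialDesignLowDegreeMatchingSide
open scoped MatrixOrder

variable {n : ℕ}

/-! ### §1 Cut bookkeeping of edge sets -/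

/-- An edge with `cutCount U e = 2` has both ends in `U`. [folklore] -/
theorem mem_of_cutCount_two {U : Finset (Fin n)} {e : Sym2 (Fin n)} (he : cutCount U e = 2) {v : Fin n} (hv : v ∈ e) : v ∈ U := by
  induction e using Sym2.ind with
  | h a b =>
    rw [cutCount_mk] at he
    have ha1 : (if a ∈ U then 1 else 0) ≤ 1 := by split_ifs <;> norm_num
    have hb1 : (if b ∈ U then 1 else 0) ≤ 1 := by split_ifs <;> norm_num
    rcases Sym2.mem_iff.1 hv with rfl | rfl
    · by_contra h; rw [if_neg h] at he; omega
    · by_contra h; rw [if_neg h] at he; omega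

/-- An edge with `cutCount U e = 0` has both ends outside `U`. [folklore] -/
theorem not_mem_of_cutCount_zero {U : Finset (Fin n)} {e : Sym2 (Fin n)} (he : cutCount U e = 0) {v : Fin n} (hv : v ∈ e) : v ∉ U := by
  induction e using Sym2.ind with
  | h a b =>
    rw [cutCount_mk] at he
    rcases Sym2.mem_iff.1 hv with rfl | rfl
    · intro h; rw [if_pos h] at he; omega
    · intro h; rw [if_pos h] at he; omega

/-- `|G| = #in + #cross + #out` for the three cut counts `2, 1, 0`. [folklore] -/
theorem card_eq_card_filter_three (U : Finset (Fin n)) (G : Finset (Sym2 (Fin n))) :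
    G.card = (G.filter fun e => cutCount U e = 2).card + (G.filter fun e => cutCount U e = 1).card +
      (G.filter fun e => cutCount U e = 0).card := by
  classical
  have h1 : G = (G.filter fun e => cutCount U e = 2) ∪ ((G.filter fun e => cutCount U e = 1) ∪ (G.filter fun e => cutCount U e = 0)) := by
    ext e
    simp only [mem_union, mem_filter]
    constructor
    · intro he
      have := cutCount_le_two U e
      rcases Nat.lt_or_ge (cutCount U e) 1 with h | h
      · exact Or.inr (Or.inr ⟨he, by omega⟩)
      · rcases Nat.lt_or_ge (cutCount U e) 2 with h' | h'
        · exact Or.inr (Or.inl ⟨he, by omega⟩)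
        · exact Or.inl ⟨he, by omega⟩
    · rintro (h | h | h) <;> exact h.1
  have hd1 : Disjoint (G.filter fun e => cutCount U e = 1) (G.filter fun e => cutCount U e = 0) :=
    disjoint_filter.2 fun e _ h1 h2 => by omega
  have hd2 : Disjoint (G.filter fun e => cutCount U e = 2)
      ((G.filter fun e => cutCount U e = 1) ∪ (G.filter fun e => cutCount U e = 0)) := by
    rw [disjoint_union_right]
    exact ⟨disjoint_filter.2 fun e _ h1 h2 => by omega, disjoint_filter.2 fun e _ h1 h2 => by omega⟩
  conv_lhs => rw [h1]
  rw [card_union_of_disjoint hd2, card_union_of_disjoint hd1, add_assoc]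

/-! ### §2 Extension to a perfect matching splits over the two sides of the cut -/

/-- A sub-edge-set of a perfect matching of `K_n` that lies inside a vertex set `W'` covers only vertices of `W'`. [folklore] -/
theorem verts_subset_of_forall {G : Finset (Sym2 (Fin n))} {W' : Finset (Fin n)} (hG : ∀ e ∈ G, ∀ v ∈ e, v ∈ W') :
    (univ.filter fun v : Fin n => ∃ e ∈ G, v ∈ e) ⊆ W' := by
  intro v hv
  obtain ⟨-, e, he, hve⟩ := mem_filter.1 hv
  exact hG e he v hve

/-- **Extension splits over the cut.** Let `n` be even and `G` an edge set with no `U`-crossing edge. Then some perfect matching of `K_n` contains `G`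
iff some perfect matching contains its part inside `U` AND some perfect matching contains its part inside `Ū`. [folklore] -/
theorem extends_iff_parts_extend (hn : Even n) (U : Finset (Fin n)) {G : Finset (Sym2 (Fin n))}
    (hG : (G.filter fun e => cutCount U e = 1).card = 0) :
    ((univ : Finset (PMatch n)).filter fun M => G ⊆ M.1).Nonempty ↔
      ((univ : Finset (PMatch n)).filter fun M => (G.filter fun e => cutCount U e = 2) ⊆ M.1).Nonempty ∧
      ((univ : Finset (PMatch n)).filter fun M => (G.filter fun e => cutCount U e = 0) ⊆ M.1).Nonempty := by
  classical
  constructor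
  · rintro ⟨M, hM⟩
    have hGM : G ⊆ M.1 := (mem_filter.1 hM).2
    exact ⟨⟨M, mem_filter.2 ⟨mem_univ _, (filter_subset _ _).trans hGM⟩⟩,
      ⟨M, mem_filter.2 ⟨mem_univ _, (filter_subset _ _).trans hGM⟩⟩⟩
  · rintro ⟨⟨M₁, hM₁⟩, ⟨M₂, hM₂⟩⟩
    set Gi := G.filter (fun e => cutCount U e = 2) with hGi
    set Go := G.filter (fun e => cutCount U e = 0) with hGo
    have h1 : Gi ⊆ M₁.1 := (mem_filter.1 hM₁).2
    have h2 : Go ⊆ M₂.1 := (mem_filter.1 hM₂).2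
    -- the two parts are perfect matchings of the vertices they cover
    set W₁ := (univ : Finset (Fin n)).filter (fun v => ∃ e ∈ Gi, v ∈ e) with hW₁
    set W₂ := (univ : Finset (Fin n)).filter (fun v => ∃ e ∈ Go, v ∈ e) with hW₂
    have hP₁ : IsPMOn W₁ Gi := isPMOn_verts M₁.2 h1
    have hP₂ : IsPMOn W₂ Go := isPMOn_verts M₂.2 h2
    have hW₁U : W₁ ⊆ U := verts_subset_of_forall fun e he v hv => mem_of_cutCount_two (mem_filter.1 he).2 hv
    have hW₂U : ∀ v ∈ W₂, v ∉ U := fun v hv => by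
      obtain ⟨-, e, he, hve⟩ := mem_filter.1 hv
      exact not_mem_of_cutCount_zero (mem_filter.1 he).2 hve
    have hd : Disjoint W₁ W₂ := disjoint_left.2 fun v hv1 hv2 => hW₂U v hv2 (hW₁U hv1)
    have hP : IsPMOn (W₁ ∪ W₂) (Gi ∪ Go) := hP₁.union hP₂ hd
    -- `G = Gi ∪ Go` (no crossing edges)
    have hGeq : G = Gi ∪ Go := by
      ext e
      simp only [hGi, hGo, mem_union, mem_filter]
      constructor
      · intro he
        have h2' := cutCount_le_two U e
        have hne : cutCount U e ≠ 1 := by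
          intro h1'
          have : e ∈ G.filter (fun e => cutCount U e = 1) := mem_filter.2 ⟨he, h1'⟩
          rw [card_eq_zero] at hG
          rw [hG] at this
          exact absurd this (notMem_empty e)
        rcases Nat.lt_or_ge (cutCount U e) 1 with h | h
        · exact Or.inr ⟨he, by omega⟩
        · exact Or.inl ⟨he, by omega⟩
      · rintro (h | h) <;> exact h.1
    -- extend by a perfect matching of the uncovered vertices
    set R := (univ : Finset (Fin n)) \ (W₁ ∪ W₂) with hR
    have hReven : Even R.card := by
      have hc : (W₁ ∪ W₂).card = 2 * (Gi ∪ Go).card := by rw [two_mul_card_eq hP]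
      rw [hR, card_sdiff_of_subset (subset_univ _), card_univ, Fintype.card_fin, hc]
      obtain ⟨a, ha⟩ := hn
      exact ⟨a - (Gi ∪ Go).card, by omega⟩
    obtain ⟨N, hN⟩ := exists_isPMOn_of_even R.card R rfl hReven
    have hdR : Disjoint (W₁ ∪ W₂) R := disjoint_sdiff
    have hPM : IsPMOn ((W₁ ∪ W₂) ∪ R) ((Gi ∪ Go) ∪ N) := hP.union hN hdR
    have huniv : (W₁ ∪ W₂) ∪ R = univ := union_sdiff_of_subset (subset_univ _)
    rw [huniv] at hPM
    refine ⟨⟨(Gi ∪ Go) ∪ N, hPM⟩, mem_filter.2 ⟨mem_univ _, ?_⟩⟩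
    rw [hGeq]
    exact subset_union_left

/-! ### §3 Kronecker products of nonnegative forms -/

/-- A real psd matrix on a finite index type is a Gram matrix: `Y(b,a) = Σ_l S(l,a) S(l,b)`. [folklore] -/
theorem exists_gram_of_posSemidef' {ι : Type*} [Fintype ι] [DecidableEq ι] {Y : Matrix ι ι ℝ} (hY : Y.PosSemidef) :
    ∃ S : Matrix ι ι ℝ, ∀ a b, Y b a = ∑ l, S l a * S l b := by
  set S : Matrix ι ι ℝ := CFC.sqrt Y with hS
  have hSpsd : S.PosSemidef := (CFC.sqrt_nonneg Y).posSemidef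
  have hSS : S * S = Y := CFC.sqrt_mul_sqrt_self Y hY.nonneg
  have hSH : Sᴴ = S := hSpsd.1
  refine ⟨S, fun a b => ?_⟩
  rw [← hSS, Matrix.mul_apply]
  refine sum_congr rfl fun l _ => ?_
  have h1 : S b l = S l b := by
    have := congrFun (congrFun hSH l) b
    rw [conjTranspose_apply, star_trivial] at this
    exact this
  rw [h1]; ring

/-- Regrouping a double sum along the fibres of a map: `Σ_{a,a'} g(a) g'(a') V(q a, q a') = Σ_{c,c'} (Σ_{q a = c} g)(Σ_{q a' = c'} g') V(c,c')`.
[folklore] -/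
theorem sum_sum_fiber_regroup {α κ : Type*} [Fintype α] [Fintype κ] [DecidableEq κ] (q : α → κ) (g g' : α → ℝ) (V : κ → κ → ℝ) :
    ∑ a, ∑ a', g a * g' a' * V (q a) (q a') =
      ∑ c, ∑ c', (∑ a ∈ univ.filter (fun a => q a = c), g a) * (∑ a' ∈ univ.filter (fun a' => q a' = c'), g' a') * V c c' := by
  symm
  calc ∑ c, ∑ c', (∑ a ∈ univ.filter (fun a => q a = c), g a) * (∑ a' ∈ univ.filter (fun a' => q a' = c'), g' a') * V c c'
      = ∑ c, ∑ c', ∑ a ∈ univ.filter (fun a => q a = c), ∑ a' ∈ univ.filter (fun a' => q a' = c'),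
          g a * g' a' * V (q a) (q a') := by
        refine sum_congr rfl fun c _ => sum_congr rfl fun c' _ => ?_
        rw [sum_mul_sum, sum_mul]
        refine sum_congr rfl fun a ha => ?_
        rw [sum_mul]
        refine sum_congr rfl fun a' ha' => ?_
        rw [(mem_filter.1 ha).2, (mem_filter.1 ha').2]
    _ = ∑ c, ∑ a ∈ univ.filter (fun a => q a = c), ∑ c', ∑ a' ∈ univ.filter (fun a' => q a' = c'),
          g a * g' a' * V (q a) (q a') := sum_congr rfl fun c _ => sum_comm
    _ = ∑ a, ∑ c', ∑ a' ∈ univ.filter (fun a' => q a' = c'), g a * g' a' * V (q a) (q a') := by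
        rw [sum_fiberwise univ q]
    _ = ∑ a, ∑ a', g a * g' a' * V (q a) (q a') := sum_congr rfl fun a _ => by rw [sum_fiberwise univ q]

/-- **KRONECKER PRODUCT OF NONNEGATIVE FORMS.** If `T` is a symmetric nonnegative quadratic form on `β` and `V` a nonnegative quadratic form on `κ`,
then for any `p : α → β`, `q : α → κ` and `f : α → ℝ`: `Σ_{a,a'} f_a f_{a'}·T(p a, p a')·V(q a, q a') ≥ 0`. [folklore] -/
theorem kronecker_form_nonneg {α β κ : Type*} [Fintype α] [Fintype β] [DecidableEq β] [Fintype κ] [DecidableEq κ]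
    (T : β → β → ℝ) (hTs : ∀ b b', T b b' = T b' b) (hT : ∀ δ : β → ℝ, 0 ≤ ∑ b, ∑ b', δ b * δ b' * T b b')
    (V : κ → κ → ℝ) (hV : ∀ δ : κ → ℝ, 0 ≤ ∑ c, ∑ c', δ c * δ c' * V c c')
    (p : α → β) (q : α → κ) (f : α → ℝ) :
    0 ≤ ∑ a, ∑ a', f a * f a' * (T (p a) (p a') * V (q a) (q a')) := by
  classical
  -- `T` as a psd matrix, and its Gram factor
  have hpsd : (Matrix.of fun b b' => T b b').PosSemidef := by
    refine PosSemidef.of_dotProduct_mulVec_nonneg ?_ fun x => ?_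
    · ext b b'
      rw [conjTranspose_apply, star_trivial, of_apply, of_apply, hTs]
    · have hx : star x = x := by ext i; simp
      rw [hx]
      have : x ⬝ᵥ ((Matrix.of fun b b' => T b b') *ᵥ x) = ∑ b, ∑ b', x b * x b' * T b b' := by
        unfold dotProduct mulVec
        refine sum_congr rfl fun b _ => ?_
        simp only [of_apply]
        unfold dotProduct
        rw [mul_sum]
        exact sum_congr rfl fun b' _ => by ring
      rw [this]; exact hT x
  obtain ⟨S, hS⟩ := exists_gram_of_posSemidef' hpsd
  have hTeq : ∀ b b', T b b' = ∑ l, S l b' * S l b := fun b b' => by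
    have := hS b' b
    rw [of_apply] at this
    exact this
  -- expand `T`, pull `Σ_l` out, regroup along the fibres of `q`, apply `hV`
  calc (0 : ℝ) ≤ ∑ l, ∑ c, ∑ c', (∑ a ∈ univ.filter (fun a => q a = c), S l (p a) * f a) *
        (∑ a' ∈ univ.filter (fun a' => q a' = c'), S l (p a') * f a') * V c c' :=
        sum_nonneg fun l _ => hV _
    _ = ∑ l, ∑ a, ∑ a', (S l (p a) * f a) * (S l (p a') * f a') * V (q a) (q a') :=
        sum_congr rfl fun l _ => (sum_sum_fiber_regroup q _ _ V).symm
    _ = ∑ a, ∑ a', f a * f a' * (T (p a) (p a') * V (q a) (q a')) := by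
        rw [sum_comm]
        refine sum_congr rfl fun a _ => ?_
        rw [sum_comm]
        refine sum_congr rfl fun a' _ => ?_
        rw [hTeq, sum_mul, mul_sum]
        exact sum_congr rfl fun l _ => by ring

/-! ### §4 The virtual form around a cut from the two one-clique forms -/

/-- **`hPSD` FROM THE ONE-CLIQUE FORMS.** Let `n` be even and `U` a cut (the parameter `t`, in the application `|U|`, only enters the moments). Suppose the pseudo-matching forms of the two odd cliques are nonnegative on
coefficient vectors indexed by `{F : |F| ≤ k}`: `Σ_{A,A'} δ_A δ_{A'} ν_U(A ∪ A') ≥ 0` with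
`ν_U(G) = [G ⊆ E(U) and G extends to a perfect matching]·∏_{j<|G|}(t−1−2j)⁻¹`, and the same for `Ū` with `n − t`. Then the Grigoriev ⊗ Grigoriev
virtual form `γ ↦ Σ_{F,F'} γ_F γ_{F'} μ_U(F ∪ F')` of brick `…LowDegreeMatchingSide` is nonnegative.
[cite: Potechin2019, Thm. 1.2, Example 3.4 and Cor. 3.10 (LIPIcs 124, 61:4–61:9)] [cite: Grigoriev2001TCS, Cor. 2 (p. 622)] -/
theorem virtualForm_nonneg_of_clique_forms (hn : Even n) (U : OddSet n) {t k : ℕ}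
    (hU : ∀ δ : {F : Finset (Sym2 (Fin n)) // F.card ≤ k} → ℝ,
      0 ≤ ∑ A, ∑ A', δ A * δ A' *
        (if ((univ : Finset (PMatch n)).filter fun M => A.1 ∪ A'.1 ⊆ M.1).Nonempty ∧ (∀ e ∈ A.1 ∪ A'.1, cutCount U.1 e = 2) then
          (∏ j ∈ range (A.1 ∪ A'.1).card, ((t : ℝ) - 1 - 2 * j))⁻¹ else 0))
    (hUc : ∀ δ : {F : Finset (Sym2 (Fin n)) // F.card ≤ k} → ℝ,
      0 ≤ ∑ A, ∑ A', δ A * δ A' *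
        (if ((univ : Finset (PMatch n)).filter fun M => A.1 ∪ A'.1 ⊆ M.1).Nonempty ∧ (∀ e ∈ A.1 ∪ A'.1, cutCount U.1 e = 0) then
          (∏ j ∈ range (A.1 ∪ A'.1).card, (((n - t : ℕ) : ℝ) - 1 - 2 * j))⁻¹ else 0))
    (γ : {F : Finset (Sym2 (Fin n)) // F.card ≤ k} → ℝ) :
    0 ≤ ∑ F, ∑ F', γ F * γ F' *
      (if ((univ : Finset (PMatch n)).filter fun M => F.1 ∪ F'.1 ⊆ M.1).Nonempty then
        (if ((F.1 ∪ F'.1).filter fun e => cutCount U.1 e = 1).card = 0 then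
          (∏ j ∈ range ((F.1 ∪ F'.1).filter fun e => cutCount U.1 e = 2).card, ((t : ℝ) - 1 - 2 * j))⁻¹ *
          (∏ j ∈ range ((F.1 ∪ F'.1).card - ((F.1 ∪ F'.1).filter fun e => cutCount U.1 e = 1).card -
              ((F.1 ∪ F'.1).filter fun e => cutCount U.1 e = 2).card), (((n - t : ℕ) : ℝ) - 1 - 2 * j))⁻¹ else 0)
      else 0) := by
  classical
  -- the one-clique kernels and the projections to the two sides
  set T : {F : Finset (Sym2 (Fin n)) // F.card ≤ k} → {F : Finset (Sym2 (Fin n)) // F.card ≤ k} → ℝ := fun A A' =>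
    if ((univ : Finset (PMatch n)).filter fun M => A.1 ∪ A'.1 ⊆ M.1).Nonempty ∧ (∀ e ∈ A.1 ∪ A'.1, cutCount U.1 e = 2) then
      (∏ j ∈ range (A.1 ∪ A'.1).card, ((t : ℝ) - 1 - 2 * j))⁻¹ else 0 with hTdef
  set V : {F : Finset (Sym2 (Fin n)) // F.card ≤ k} → {F : Finset (Sym2 (Fin n)) // F.card ≤ k} → ℝ := fun A A' =>
    if ((univ : Finset (PMatch n)).filter fun M => A.1 ∪ A'.1 ⊆ M.1).Nonempty ∧ (∀ e ∈ A.1 ∪ A'.1, cutCount U.1 e = 0) then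
      (∏ j ∈ range (A.1 ∪ A'.1).card, (((n - t : ℕ) : ℝ) - 1 - 2 * j))⁻¹ else 0 with hVdef
  set p : {F : Finset (Sym2 (Fin n)) // F.card ≤ k} → {F : Finset (Sym2 (Fin n)) // F.card ≤ k} := fun F =>
    ⟨F.1.filter fun e => cutCount U.1 e = 2, (card_filter_le _ _).trans F.2⟩ with hp
  set q : {F : Finset (Sym2 (Fin n)) // F.card ≤ k} → {F : Finset (Sym2 (Fin n)) // F.card ≤ k} := fun F =>
    ⟨F.1.filter fun e => cutCount U.1 e = 0, (card_filter_le _ _).trans F.2⟩ with hq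
  -- the coefficients restricted to non-crossing edge sets
  set f : {F : Finset (Sym2 (Fin n)) // F.card ≤ k} → ℝ := fun F =>
    if (F.1.filter fun e => cutCount U.1 e = 1).card = 0 then γ F else 0 with hf
  have hTs : ∀ b b', T b b' = T b' b := fun b b' => by simp only [hTdef, union_comm]
  have hkron := kronecker_form_nonneg T hTs hU V hUc p q f
  refine le_of_le_of_eq hkron (sum_congr rfl fun F _ => sum_congr rfl fun F' _ => ?_)
  -- pointwise identification of the two kernels
  by_cases hc : (F.1.filter fun e => cutCount U.1 e = 1).card = 0 ∧ (F'.1.filter fun e => cutCount U.1 e = 1).card = 0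
  · obtain ⟨hcF, hcF'⟩ := hc
    have hfF : f F = γ F := by simp only [hf, hcF, if_true]
    have hfF' : f F' = γ F' := by simp only [hf, hcF', if_true]
    rw [hfF, hfF']
    -- the union has no crossing edge
    have hG : ((F.1 ∪ F'.1).filter fun e => cutCount U.1 e = 1).card = 0 := by
      rw [filter_union, card_eq_zero, union_eq_empty, ← card_eq_zero, ← card_eq_zero]; exact ⟨hcF, hcF'⟩
    have hpU : (p F).1 ∪ (p F').1 = (F.1 ∪ F'.1).filter fun e => cutCount U.1 e = 2 := by
      simp only [hp, filter_union]
    have hqU : (q F).1 ∪ (q F').1 = (F.1 ∪ F'.1).filter fun e => cutCount U.1 e = 0 := by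
      simp only [hq, filter_union]
    have hin : ∀ e ∈ (F.1 ∪ F'.1).filter (fun e => cutCount U.1 e = 2), cutCount U.1 e = 2 := fun e he => (mem_filter.1 he).2
    have hout : ∀ e ∈ (F.1 ∪ F'.1).filter (fun e => cutCount U.1 e = 0), cutCount U.1 e = 0 := fun e he => (mem_filter.1 he).2
    have hcard : (F.1 ∪ F'.1).card - 0 - ((F.1 ∪ F'.1).filter fun e => cutCount U.1 e = 2).card =
        ((F.1 ∪ F'.1).filter fun e => cutCount U.1 e = 0).card := by
      have := card_eq_card_filter_three U.1 (F.1 ∪ F'.1)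
      omega
    have hext := extends_iff_parts_extend hn U.1 hG
    simp only [hTdef, hVdef, hpU, hqU, hG, hcard]
    -- drop the (automatic) 'inside' conditions
    have e2 : ((((univ : Finset (PMatch n)).filter fun M => ((F.1 ∪ F'.1).filter fun e => cutCount U.1 e = 2) ⊆ M.1).Nonempty ∧
        ∀ e ∈ (F.1 ∪ F'.1).filter (fun e => cutCount U.1 e = 2), cutCount U.1 e = 2) ↔
        ((univ : Finset (PMatch n)).filter fun M => ((F.1 ∪ F'.1).filter fun e => cutCount U.1 e = 2) ⊆ M.1).Nonempty) :=
      ⟨fun h => h.1, fun h => ⟨h, hin⟩⟩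
    have e0 : ((((univ : Finset (PMatch n)).filter fun M => ((F.1 ∪ F'.1).filter fun e => cutCount U.1 e = 0) ⊆ M.1).Nonempty ∧
        ∀ e ∈ (F.1 ∪ F'.1).filter (fun e => cutCount U.1 e = 0), cutCount U.1 e = 0) ↔
        ((univ : Finset (PMatch n)).filter fun M => ((F.1 ∪ F'.1).filter fun e => cutCount U.1 e = 0) ⊆ M.1).Nonempty) :=
      ⟨fun h => h.1, fun h => ⟨h, hout⟩⟩
    simp only [e2, e0]
    by_cases h2 : ((univ : Finset (PMatch n)).filter fun M => ((F.1 ∪ F'.1).filter fun e => cutCount U.1 e = 2) ⊆ M.1).Nonempty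
    · by_cases h0 : ((univ : Finset (PMatch n)).filter fun M => ((F.1 ∪ F'.1).filter fun e => cutCount U.1 e = 0) ⊆ M.1).Nonempty
      · have hc := hext.2 ⟨h2, h0⟩
        simp only [h2, h0, hc, if_true]
      · have hc : ¬ ((univ : Finset (PMatch n)).filter fun M => F.1 ∪ F'.1 ⊆ M.1).Nonempty := fun h => h0 (hext.1 h).2
        simp only [h2, h0, hc, if_true, if_false, mul_zero]
    · have hc : ¬ ((univ : Finset (PMatch n)).filter fun M => F.1 ∪ F'.1 ⊆ M.1).Nonempty := fun h => h2 (hext.1 h).1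
      simp only [h2, hc, if_false, zero_mul, mul_zero]
  · -- some crossing edge: both sides vanish
    have hf0 : f F * f F' = 0 := by
      rcases not_and_or.1 hc with h | h
      · simp only [hf, h, if_false, zero_mul]
      · simp only [hf, h, if_false, mul_zero]
    have hG : ((F.1 ∪ F'.1).filter fun e => cutCount U.1 e = 1).card ≠ 0 := by
      rw [filter_union]
      intro h0
      rw [card_eq_zero, union_eq_empty, ← card_eq_zero, ← card_eq_zero] at h0
      exact hc h0
    rw [hf0, zero_mul, if_neg hG]
    split_ifs <;> ring

/-- **MATCHING-SIDE LOW-DEGREE PRICING FROM THE ONE-CLIQUE PSD STATEMENTS.** For `n` even, an exact design of degree `D` on the `t`-cuts, an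
arbitrary psd cut family `X`, and `B` of matching-degree `≤ k` with `2k ≤ D`: if for every `t`-cut `U` the pseudo-matching forms of `K_U` (moments
`∏_{j<|G|}(t−1−2j)⁻¹`) and of `K_Ū` (moments `∏_{j<|G|}(n−t−1−2j)⁻¹`) are nonnegative on `{F : |F| ≤ k}` — Potechin's theorem for the two odd
cliques when `4k + 1 ≤ min(t, n − t)` — then `Σ_U Σ_M levelWeight(U,M)·tr(X_U B_M B_Mᵀ) ≤ 0`.
[cite: Potechin2019, Thm. 1.2 and Cor. 3.10 (LIPIcs 124, 61:4, 61:9)] [cite: Rothvoss2017, §2 (PDF p. 6)] -/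
theorem sum_levelWeight_trace_nonpos_of_lowDegreeM_of_clique_forms (hn : Even n) {t T D : ℕ} {Bv : ℝ} {C : Finset ℕ} {w : ℕ → ℝ}
    (hdes : IsExactDesign n t T D Bv C w) {r m k : ℕ} (h2k : 2 * k ≤ D)
    (X : OddSet n → Matrix (Fin r) (Fin r) ℝ) (hX : ∀ U, (X U).PosSemidef)
    (B : PMatch n → Matrix (Fin r) (Fin m) ℝ) (hB : IsLowDegreeM n k B)
    (hU : ∀ U : OddSet n, U.1.card = t → ∀ δ : {F : Finset (Sym2 (Fin n)) // F.card ≤ k} → ℝ,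
      0 ≤ ∑ A, ∑ A', δ A * δ A' *
        (if ((univ : Finset (PMatch n)).filter fun M => A.1 ∪ A'.1 ⊆ M.1).Nonempty ∧ (∀ e ∈ A.1 ∪ A'.1, cutCount U.1 e = 2) then
          (∏ j ∈ range (A.1 ∪ A'.1).card, ((t : ℝ) - 1 - 2 * j))⁻¹ else 0))
    (hUc : ∀ U : OddSet n, U.1.card = t → ∀ δ : {F : Finset (Sym2 (Fin n)) // F.card ≤ k} → ℝ,
      0 ≤ ∑ A, ∑ A', δ A * δ A' *
        (if ((univ : Finset (PMatch n)).filter fun M => A.1 ∪ A'.1 ⊆ M.1).Nonempty ∧ (∀ e ∈ A.1 ∪ A'.1, cutCount U.1 e = 0) then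
          (∏ j ∈ range (A.1 ∪ A'.1).card, (((n - t : ℕ) : ℝ) - 1 - 2 * j))⁻¹ else 0)) :
    ∑ U, ∑ M, levelWeight n t C w U M * (X U * (B M * (B M)ᵀ)).trace ≤ 0 :=
  sum_levelWeight_trace_nonpos_of_lowDegreeM hdes h2k X hX B hB
    fun U hUt γ => virtualForm_nonneg_of_clique_forms hn U (hU U hUt) (hUc U hUt) γ

end Summit.PneNP.PneNP.Theorems.ChebyshevTracialDesignPseudoMatchingTensor
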